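import Literature.AlgebraicGeometry.Resolution.BlowupsFlatBaseChange
import Literature.AlgebraicGeometry.Resolution.HilbertSamuelLocal
import Mathlib.AlgebraicGeometry.Noetherian
import Mathlib.Topology.NoetherianSpace
import HarnessLib

/-!
# Route `HilbertSamuelElimination`, crux `SigmaMaxModificationsCorridor3`
# (stmt-ResolutionOfSingularities-19249; child of `SigmaMaxModifications` stmt-…-18506),
# line `tame_wild` v3: CONFINEMENT ladder, rows C1 / C3 / C3c / C4 (scheme-theoretic
# infrastructure of the confinement round)

[OURS · L1 W4.2] Rows C1, C3, C3c of `L/w42/helpers-v3.1.lean` (CHAIN v3.1 §5, stub-1) by name, and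
the flat-base-change half of row C4, for the confinement stub `TameWild.stub_confine3` of the
registered skeleton tame_wild v3 (lead-1, 2026-08-26T23:31Z): the round lemma C5 works in the local
scheme `W = Y_n ×_Y Spec 𝒪_{Y,ξ}` at a non-closed point `ξ` of the threefold `Y`. NOT a statement of
any manuscript.

* `stub_C1_finite_of_isClosed_of_forall_isClosed_singleton` (C1, verbatim) — a closed subset of a
  Noetherian scheme all of whose points are closed is finite (its irreducible components are closures
  of generic points, which are singletons).
* `stub_C3c_ringKrullDim_stalk_le_two_of_not_isClosed` (C3c, verbatim) — at a non-closed point of a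
  scheme of dimension `≤ 3` the local ring has dimension `≤ 2` (`height + coheight ≤ dim` —
  `Literature.AlgebraicGeometry.Dimension.height_add_coheight_le_topologicalKrullDim`, inlined to keep
  the imports light —, `dim 𝒪_{Y,ξ} = coheight ξ`, and a non-closed point has a proper specialisation).
* `stub_C3_hsFun_pullback_fromSpecStalk` (C3; the typed signature plus `[IsLocallyNoetherian X]`,
  which the tree's `hilbertFun` transport needs and every application has) — the projection
  `X ×_Y Spec 𝒪_{Y,ξ} → X` induces isomorphisms of local rings (tree:
  `isIso_stalkMap_pullback_fst_fromSpecStalk`, a flat preimmersion), hence preserves `H^N`;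
  `hsStratum_pullback_fromSpecStalk` — `W(ν) = pr⁻¹ X(ν)`; `range_pullback_fst_fromSpecStalk` (tree)
  — the points of `W` are those of `X` over generisations of `ξ`.
* `flat_pullback_fst_fromSpecStalk`, `isBlowup_pullback_snd_of_isBlowup_fromSpecStalk` (C4, flat base
  change half) — `X ×_Y Spec 𝒪_{Y,ξ} → X` is flat, so a blow-up `X' → X` along `D` pulls back to the
  blow-up of `X ×_Y Spec 𝒪_{Y,ξ}` along the pulled-back centre (tree: `flat_fromSpecStalk`,
  `IsBlowup.pullback_snd_of_flat`, Stacks 0805).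

## Sources

* The Stacks Project, Tags 0052 (Noetherian spaces), 01J7 (`Spec 𝒪_{X,x} → X`), 0805 (blowing up
  commutes with flat base change), 02IZ. [StacksProject]
* V. Cossart, U. Jannsen, S. Saito, LNM 2270 (2020), Def. 2.28, Rem. 6.29. [CossartJannsenSaito2020]
-/

set_option linter.dupNamespace false -- mandated namespace of this single-conjunct summit

noncomputable section

open CategoryTheory CategoryTheory.Limits AlgebraicGeometry TopologicalSpace Topology Order
open Literature.AlgebraicGeometry.Resolution Literature.RingTheory.HilbertSamuel

namespace Summit.ResolutionOfSingularities.ResolutionOfSingularities.Theorems.SigmaMaxModificationsCorridor3.Helpers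

universe u

/-! ## C1: closed sets of closed points are finite -/

/-- **C1 (stub-1, S): a closed subset of a Noetherian scheme all of whose points are closed points is
finite** (its irreducible components are closures of generic points — sober — which are closed points, hence
singletons; a Noetherian space has finitely many irreducible components). Plan-1's typed signature
(`L/w42/helpers-v3.1.lean`) verbatim. [OURS · L1 W4.2] row C1 of CHAIN v3.1; NOT a statement of the
manuscript. [cite: StacksProject, Tag 0052] -/
theorem stub_C1_finite_of_isClosed_of_forall_isClosed_singleton
    (Y : Scheme.{0}) [IsNoetherian Y] (T : Set Y) (hT : IsClosed T)
    (hcl : ∀ y ∈ T, IsClosed ({y} : Set Y)) : T.Finite := by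
  obtain ⟨S, hSfin, hSclosed, hSirr, hTS⟩ := NoetherianSpace.exists_finite_set_isClosed_irreducible hT
  rw [hTS]
  refine hSfin.sUnion fun t ht => ?_
  have hirr : IsIrreducible t := hSirr t ht
  have htc : IsClosed t := hSclosed t ht
  -- the generic point of the irreducible closed `t` is a closed point, so `t` is a singleton
  obtain ⟨η, hη⟩ : ∃ η : Y, IsGenericPoint η t := by
    have h := hirr.isGenericPoint_genericPoint_closure
    rw [htc.closure_eq] at h
    exact ⟨_, h⟩
  have hηT : η ∈ T := by
    rw [hTS]
    exact Set.mem_sUnion_of_mem hη.mem ht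
  have hteq : t = {η} := hη.def.symm.trans (hcl η hηT).closure_eq
  rw [hteq]
  exact Set.finite_singleton η

/-! ## C3c: local rings at non-closed points of a threefold -/

/-- A non-closed point has positive height: some point is a proper specialisation of it.
[folklore] -/
theorem one_le_height_of_not_isClosed {X : Scheme.{u}} {ξ : X} (hξ : ¬ IsClosed ({ξ} : Set X)) :
    1 ≤ height ξ := by
  rw [Order.one_le_iff_ne_zero, Ne, height_eq_zero]
  intro hmin
  apply hξ
  have hcl : closure ({ξ} : Set X) = {ξ} := by
    refine Set.Subset.antisymm (fun z hz => ?_) subset_closure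
    have hξz : ξ ⤳ z := specializes_iff_mem_closure.mpr hz
    have hzξ : z ⤳ ξ := Scheme.le_iff_specializes.mp (hmin (Scheme.le_iff_specializes.mpr hξz))
    exact Set.mem_singleton_iff.mpr (hzξ.antisymm hξz).eq
  rw [← hcl]
  exact isClosed_closure

/-- **C3c (stub-1, S): at a NON-CLOSED point of a scheme of dimension `≤ 3` the local ring has dimension
`≤ 2`** (`dim 𝒪_{Y,ξ} + dim closure{ξ} ≤ dim Y` and a non-closed point has positive-dimensional
closure). Plan-1's typed signature (`L/w42/helpers-v3.1.lean`) verbatim — the finite-type hypothesis is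
not used. [OURS · L1 W4.2] row C3c of CHAIN v3.1; NOT a statement of the manuscript.
[cite: StacksProject, Tag 02IZ] -/
theorem stub_C3c_ringKrullDim_stalk_le_two_of_not_isClosed
    {k : Type} [Field k] (Y : Scheme.{0}) (g : Y ⟶ Spec (.of k)) [LocallyOfFiniteType g]
    (hdim : topologicalKrullDim Y ≤ ((3 : ℕ) : WithBot ℕ∞)) (ξ : Y) (hξ : ¬ IsClosed ({ξ} : Set Y)) :
    ringKrullDim (Y.presheaf.stalk ξ) ≤ ((2 : ℕ) : WithBot ℕ∞) := by
  rw [ringKrullDim_stalk_eq_coheight]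
  obtain ⟨M, hM⟩ : ∃ M : ℕ, M = 3 := ⟨3, rfl⟩
  obtain ⟨M₂, hM₂⟩ : ∃ M₂ : ℕ, M₂ = 2 := ⟨2, rfl⟩
  rw [← hM] at hdim
  rw [← hM₂]
  have h1 : 1 ≤ height ξ := one_le_height_of_not_isClosed hξ
  -- `height ξ + coheight ξ ≤ dim Y` (chains below and above `ξ` concatenate; cf.
  -- `Literature.AlgebraicGeometry.Dimension.height_add_coheight_le_topologicalKrullDim`)
  have hhc : ((height ξ + coheight ξ : ℕ∞) : WithBot ℕ∞) ≤ topologicalKrullDim Y := by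
    haveI : Nonempty Y := ⟨ξ⟩
    rw [show topologicalKrullDim Y = krullDim Y from
      krullDim_eq_of_orderIso (irreducibleSetEquivPoints (α := Y)),
      krullDim_eq_iSup_height_add_coheight_of_nonempty, WithBot.coe_le_coe]
    exact le_iSup (fun a : Y => height a + coheight a) ξ
  have h2 : height ξ + coheight ξ ≤ (M : ℕ∞) := by
    have h := hhc.trans hdim
    exact_mod_cast h
  have hh : height ξ ≠ ⊤ := ne_top_of_le_ne_top (ENat.coe_ne_top M) (le_self_add.trans h2)
  have hc : coheight ξ ≠ ⊤ := ne_top_of_le_ne_top (ENat.coe_ne_top M) (le_add_self.trans h2)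
  obtain ⟨a, ha⟩ := ENat.ne_top_iff_exists.mp hh
  obtain ⟨c, hc'⟩ := ENat.ne_top_iff_exists.mp hc
  rw [← ha, ← hc'] at h2
  rw [← ha] at h1
  rw [← hc']
  have h1' : 1 ≤ a := by exact_mod_cast h1
  have h2' : a + c ≤ M := by exact_mod_cast h2
  have h3 : c ≤ M₂ := by omega
  exact_mod_cast h3

/-! ## C3: the local-scheme dictionary `W = X ×_Y Spec 𝒪_{Y,ξ}` -/

/-- **C3 (stub-1, M): the local-scheme dictionary — Hilbert–Samuel functions.** For `ξ : Y` and
`W := X ×_Y Spec 𝒪_{Y,ξ}` (first projection `pr`), the local rings of `W` are those of `X` at the image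
points (the projection is a flat preimmersion: tree `isIso_stalkMap_pullback_fst_fromSpecStalk`), so the
Hilbert–Samuel functions agree pointwise. Plan-1's typed signature (`L/w42/helpers-v3.1.lean`) with the
hypothesis `[IsLocallyNoetherian X]` added (the tree's transport `hilbertFun_eq_of_ringEquiv` is stated
for Noetherian local rings; in the chain `X = s.top` is of finite type over the Noetherian `Y`).
[OURS · L1 W4.2] row C3 of CHAIN v3.1; NOT a statement of the manuscript.
[cite: CossartJannsenSaito2020, Def. 2.28] [cite: StacksProject, Tag 01J7] -/
theorem stub_C3_hsFun_pullback_fromSpecStalk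
    {X Y : Scheme.{0}} [IsLocallyNoetherian X] (f : X ⟶ Y) (ξ : Y) (N : ℕ)
    (w : ↑(pullback f (Y.fromSpecStalk ξ))) :
    Scheme.hsFun (pullback f (Y.fromSpecStalk ξ)) N w =
      Scheme.hsFun X N ((pullback.fst f (Y.fromSpecStalk ξ)).base w) := by
  haveI := isIso_stalkMap_pullback_fst_fromSpecStalk f ξ w
  exact Scheme.hsFun_eq_of_isIso_stalkMap (pullback.fst f (Y.fromSpecStalk ξ)) N w

/-- **C3, strata: `W(ν) = pr⁻¹ X(ν)`** for `W = X ×_Y Spec 𝒪_{Y,ξ}`.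
[OURS · L1 W4.2] row C3 of CHAIN v3.1; NOT a statement of the manuscript.
[cite: CossartJannsenSaito2020, Def. 2.28] -/
theorem hsStratum_pullback_fromSpecStalk
    {X Y : Scheme.{0}} [IsLocallyNoetherian X] (f : X ⟶ Y) (ξ : Y) (N : ℕ) (ν : ℕ → ℕ) :
    Scheme.hsStratum (pullback f (Y.fromSpecStalk ξ)) N ν =
      (fun w => (pullback.fst f (Y.fromSpecStalk ξ)).base w) ⁻¹' Scheme.hsStratum X N ν := by
  ext w
  rw [Set.mem_preimage, Scheme.mem_hsStratum_iff, Scheme.mem_hsStratum_iff,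
    stub_C3_hsFun_pullback_fromSpecStalk]

/-- **C3, values: `Σ_W(N) ⊆ Σ_X(N)`** for `W = X ×_Y Spec 𝒪_{Y,ξ}`; in particular a value `ν` maximal
in `Σ_X(N)` and attained on `W` is maximal in `Σ_W(N)`. [OURS · L1 W4.2] row C3 of CHAIN v3.1; NOT a
statement of the manuscript. [cite: CossartJannsenSaito2020, Def. 2.35] -/
theorem hsValues_pullback_fromSpecStalk_subset
    {X Y : Scheme.{0}} [IsLocallyNoetherian X] (f : X ⟶ Y) (ξ : Y) (N : ℕ) :
    Scheme.hsValues (pullback f (Y.fromSpecStalk ξ)) N ⊆ Scheme.hsValues X N := by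
  rintro _ ⟨w, rfl⟩
  exact ⟨_, (stub_C3_hsFun_pullback_fromSpecStalk f ξ N w).symm⟩

/-- Maximality of a value descends to `W = X ×_Y Spec 𝒪_{Y,ξ}` as soon as it is attained there.
[OURS · L1 W4.2] row C3 of CHAIN v3.1; NOT a statement of the manuscript.
[cite: CossartJannsenSaito2020, Def. 2.35] -/
theorem maximal_hsValues_pullback_fromSpecStalk
    {X Y : Scheme.{0}} [IsLocallyNoetherian X] (f : X ⟶ Y) (ξ : Y) (N : ℕ) {ν : ℕ → ℕ}
    (hν : Maximal (· ∈ Scheme.hsValues X N) ν)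
    (hmem : ν ∈ Scheme.hsValues (pullback f (Y.fromSpecStalk ξ)) N) :
    Maximal (· ∈ Scheme.hsValues (pullback f (Y.fromSpecStalk ξ)) N) ν :=
  ⟨hmem, fun _ hμ hνμ => hν.2 (hsValues_pullback_fromSpecStalk_subset f ξ N hμ) hνμ⟩

/-! ## C4 (flat base change half): blow-ups pull back along `Spec 𝒪_{Y,ξ} → Y` -/

/-- **C4, flatness: the projection `X ×_Y Spec 𝒪_{Y,ξ} → X` is flat** (base change of the flat
`Spec 𝒪_{Y,ξ} → Y`, tree `flat_fromSpecStalk`). [OURS · L1 W4.2] row C4 of CHAIN v3.1; NOT a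
statement of the manuscript. [cite: StacksProject, Tag 01J7] -/
theorem flat_pullback_fst_fromSpecStalk {X Y : Scheme.{0}} (f : X ⟶ Y) (ξ : Y) :
    Flat (pullback.fst f (Y.fromSpecStalk ξ)) := by
  haveI := flat_fromSpecStalk Y ξ
  infer_instance

/-- **C4, blow-ups commute with the flat base change `Spec 𝒪_{Y,ξ} → Y` (Stacks 0805):** if
`π : X' → X` is the blow-up of `X` along `D` and `X` lies over `Y`, then the base change of `π` to
`W = X ×_Y Spec 𝒪_{Y,ξ}` is the blow-up of `W` along the pulled-back centre (tree
`IsBlowup.pullback_snd_of_flat` applied to the flat projection `W → X`). This lifts every blow-up of a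
`CentreSeq` over `Y` to the local scheme at `ξ` and identifies the tops as iterated pullbacks.
[OURS · L1 W4.2] row C4 of CHAIN v3.1; NOT a statement of the manuscript.
[cite: StacksProject, Tag 0805] -/
theorem isBlowup_pullback_snd_of_isBlowup_fromSpecStalk {X' X Y : Scheme.{0}} {π : X' ⟶ X}
    {D : X.IdealSheafData} (hπ : IsBlowup π D) (f : X ⟶ Y) (ξ : Y) :
    IsBlowup (pullback.snd π (pullback.fst f (Y.fromSpecStalk ξ)))
      (D.comap (pullback.fst f (Y.fromSpecStalk ξ))) := by
  haveI := flat_pullback_fst_fromSpecStalk f ξ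
  exact hπ.pullback_snd_of_flat _

/-- **C4 at the base `X = Y`**: the blow-up of `Y` along `D` pulls back along `Spec 𝒪_{Y,ξ} → Y` to the
blow-up of `Spec 𝒪_{Y,ξ}` along `D_ξ`. [OURS · L1 W4.2] row C4 of CHAIN v3.1; NOT a statement of the
manuscript. [cite: StacksProject, Tag 0805] -/
theorem isBlowup_pullback_snd_fromSpecStalk {Y' Y : Scheme.{0}} {π : Y' ⟶ Y}
    {D : Y.IdealSheafData} (hπ : IsBlowup π D) (ξ : Y) :
    IsBlowup (pullback.snd π (Y.fromSpecStalk ξ)) (D.comap (Y.fromSpecStalk ξ)) := by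
  haveI := flat_fromSpecStalk Y ξ
  exact hπ.pullback_snd_of_flat _

end Summit.ResolutionOfSingularities.ResolutionOfSingularities.Theorems.SigmaMaxModificationsCorridor3.Helpers

end
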